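import Mathlib
import HarnessLib
import Summits.Ventures.LatticeQCDFlow.Exactness.BennettAcceptanceRatio
import Summits.Ventures.LatticeQCDFlow.Exactness.NCMCGeneralSpaceBennettRoot
import Summits.Ventures.LatticeQCDFlow.Exactness.NCMCGeneralSpaceEstimatorBias
import Summits.Ventures.LatticeQCDFlow.Exactness.NCMCGeneralSpaceEstimatorConsistency

/-!
# The self-consistent Bennett (BAR) estimate is strongly consistent on a general state space

HONEST FRAMING: exact (Metropolis-corrected) sampling algorithms for lattice gauge theory;
figures of merit are autocorrelation/cost numbers at stated couplings and volumes; no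
continuum-physics claim.

Venture `LatticeQCDFlow` (cell pub-lqcd), topic `Exactness`; FANOUT row 13 (`eng-snf`, GEN-15).
NEW WORK of the cell (elementary asymptotic statistics: the strong law at countably many points plus
monotonicity of the estimating equation), not a published result; nothing is cited as a fact
(C. H. Bennett, J. Comput. Phys. 22 (1976) 245; M. R. Shirts, E. Bair, G. Hooker, V. S. Pande,
Phys. Rev. Lett. 91 (2003) 140601 — the self-consistent / maximum-likelihood reading — named only).
Continuation of `NCMCGeneralSpaceBennettRoot.lean` (GEN-11: the POPULATION Bennett equation holds iff
`c = ΔF`) and of the finite `BennettAcceptanceRatio.lean` (`barFn_existsUnique_root`: the SAMPLE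
equation has exactly one root); every two-sample file so far (GEN-12 (21), GEN-14 (32)/(35)/(37))
froze the statistic `α` — THIS file treats the estimate the engine actually reports, the root of the
sample equation, whose Fermi weight is centred at the unknown root itself.

## Setting

Two probability laws `μF`, `μR` on records `E` and a measurable work `W : E → ℝ` (for a Crooks pair:
`μF = P_F = fwdPathLaw ν₀ κF`, `μR = P_R = fwdPathLaw ν₁ κR`, the reverse record carrying the
forward-direction work functional, so that Bennett's reverse Fermi term reads `σ(W − d)`); PAIRED
independent sampling `ω : ℕ → E × E` under `Measure.infinitePi (fun _ => μF ⊗ μR)` (equal sample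
sizes `nf = nr = n`, shift `M = log(nf/nr) = 0`).  The SAMPLE BENNETT GAP after `n` pairs is
`g_n(d, ω) = Σ_{i<n} σ(d − W(ω i).1) − Σ_{i<n} σ(W(ω i).2 − d)` (`σ = Real.sigmoid`; this is the
finite file's `barFn 0` with reverse works `−W`, `sampleBarGap_eq_barFn`), and the engine's estimate
`ΔF̂_BAR,n` is its root in `d`.  The POPULATION GAP is `G(d) = E_{μF} σ(d − W) − E_{μR} σ(W − d)`,
strictly increasing (`strictMono_integral_sigmoid_sub`, GEN-11).

## Content

* `sampleBarGap_monotone` / `sampleBarGap_strictMono` / `continuous_sampleBarGap` /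
  `measurable_sampleBarGap` / `sampleBarGap_eq_barFn` / **`existsUnique_sampleBarGap_root`** — the
  sample gap is continuous and (strictly, once `n ≥ 1`) increasing in `d`, jointly measurable, equal to
  the finite file's `barFn`, and has EXACTLY ONE ROOT for every `n ≥ 1` and every run.
* **`exists_measurable_barRoot`** — a measurable root selection `d̂ : ℕ → (ℕ → E × E) → ℝ` exists
  (`{d̂_n ≤ x} = {0 ≤ g_n(x, ·)}` by monotonicity): "the BAR estimate" is a random variable.
* `tendsto_sampleBarGap_div_ae` — the strong law at a FIXED `d`: `g_n(d, ω)/n → G(d)` a.s.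
* **`eventually_sampleBarGap_sign_ae`** — if `G(d⋆) = 0` then for almost every run, for every
  `δ > 0`, eventually `g_n(d, ω) < 0` for all `d ≤ d⋆ − δ` and `g_n(d, ω) > 0` for all `d ≥ d⋆ + δ`
  (strong law at the countably many points `d⋆ ± 1/(k+1)`, then monotonicity in `d`).
* **`tendsto_barRoot_ae`** — hence for almost every run EVERY sequence of roots (indeed every
  sequence `d_n` with `g_n(d_n, ω) = 0` eventually) converges to `d⋆`; the null set does not depend
  on the sequence.
* **`CrooksPair.eventually_sampleBarGap_sign_ae`**, **`CrooksPair.tendsto_barRoot_ae`**,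
  **`CrooksPair.tendsto_measurable_barRoot_ae`** — for every Crooks pair with `e^{−ΔF} = Z₁/Z₀` the
  population root is `ΔF` (`integral_sigmoid_fwd_eq_rev_iff`), so THE SELF-CONSISTENT BAR ESTIMATE IS
  STRONGLY CONSISTENT: `ΔF̂_BAR,n → ΔF` almost surely along independent paired evolutions — for
  adjoint stochastic steps, Jacobian-charged coupling layers and their concatenations alike.

Scope / NOT CLAIMED: paired (equal-size) independent evolutions only (the `a : b` block version is the
same argument with the shift `M = log(a/b)` and is not typed here); no rate, no asymptotic law of the
root (separate file), nothing for correlated chain starts; no value for any concrete protocol.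
-/

namespace Summit.Ventures.LatticeQCDFlow.Exactness.GeneralNCMC

open MeasureTheory ProbabilityTheory Set Filter Finset
open scoped ENNReal NNReal Topology

variable {E : Type*} [MeasurableSpace E]

/-! ## The sample Bennett gap: monotone, continuous, measurable, one root -/

section Sample

variable (W : E → ℝ)

omit [MeasurableSpace E] in
/-- The sample Bennett gap `d ↦ Σ_{i<n} σ(d − W_i) − Σ_{i<n} σ(W'_i − d)` is non-decreasing in `d`. -/
theorem sampleBarGap_monotone (ω : ℕ → E × E) (n : ℕ) :
    Monotone fun d : ℝ => (∑ i ∈ range n, Real.sigmoid (d - W (ω i).1)) -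
      ∑ i ∈ range n, Real.sigmoid (W (ω i).2 - d) := by
  intro a b hab
  have h1 : ∑ i ∈ range n, Real.sigmoid (a - W (ω i).1) ≤ ∑ i ∈ range n, Real.sigmoid (b - W (ω i).1) :=
    sum_le_sum fun i _ => Real.sigmoid_le (by linarith)
  have h2 : ∑ i ∈ range n, Real.sigmoid (W (ω i).2 - b) ≤ ∑ i ∈ range n, Real.sigmoid (W (ω i).2 - a) :=
    sum_le_sum fun i _ => Real.sigmoid_le (by linarith)
  dsimp only
  linarith

omit [MeasurableSpace E] in
/-- … and strictly increasing as soon as one pair has been sampled (`n ≥ 1`). -/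
theorem sampleBarGap_strictMono (ω : ℕ → E × E) {n : ℕ} (hn : 1 ≤ n) :
    StrictMono fun d : ℝ => (∑ i ∈ range n, Real.sigmoid (d - W (ω i).1)) -
      ∑ i ∈ range n, Real.sigmoid (W (ω i).2 - d) := by
  intro a b hab
  have hne : (range n).Nonempty := nonempty_range_iff.2 (by omega)
  have h1 : ∑ i ∈ range n, Real.sigmoid (a - W (ω i).1) < ∑ i ∈ range n, Real.sigmoid (b - W (ω i).1) :=
    sum_lt_sum_of_nonempty hne fun i _ => Real.sigmoid_lt (by linarith)
  have h2 : ∑ i ∈ range n, Real.sigmoid (W (ω i).2 - b) ≤ ∑ i ∈ range n, Real.sigmoid (W (ω i).2 - a) :=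
    sum_le_sum fun i _ => Real.sigmoid_le (by linarith)
  dsimp only
  linarith

omit [MeasurableSpace E] in
/-- The sample Bennett gap is continuous in `d`. -/
theorem continuous_sampleBarGap (ω : ℕ → E × E) (n : ℕ) :
    Continuous fun d : ℝ => (∑ i ∈ range n, Real.sigmoid (d - W (ω i).1)) -
      ∑ i ∈ range n, Real.sigmoid (W (ω i).2 - d) := by
  refine Continuous.sub ?_ ?_
  · exact continuous_finsetSum _ fun i _ => _root_.continuous_sigmoid.comp (by fun_prop)
  · exact continuous_finsetSum _ fun i _ => _root_.continuous_sigmoid.comp (by fun_prop)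

variable {W} in
/-- The sample Bennett gap at a fixed `d` is a measurable function of the run. -/
theorem measurable_sampleBarGap (hW : Measurable W) (n : ℕ) (d : ℝ) :
    Measurable fun ω : ℕ → E × E => (∑ i ∈ range n, Real.sigmoid (d - W (ω i).1)) -
      ∑ i ∈ range n, Real.sigmoid (W (ω i).2 - d) := by
  refine Measurable.sub ?_ ?_
  · refine Finset.measurable_sum _ fun i _ => _root_.continuous_sigmoid.measurable.comp ?_
    exact measurable_const.sub (hW.comp (measurable_fst.comp (measurable_pi_apply i)))
  · refine Finset.measurable_sum _ fun i _ => _root_.continuous_sigmoid.measurable.comp ?_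
    exact (hW.comp (measurable_snd.comp (measurable_pi_apply i))).sub measurable_const

omit [MeasurableSpace E] in
/-- **The sample gap is the finite file's `barFn`** (shift `M = 0`, forward works `W(ω i).1`,
reverse works `−W(ω i).2`: `fermiWeight t = σ(−t)`) — the function whose root `snf.estimators.bar`
returns. -/
theorem sampleBarGap_eq_barFn (ω : ℕ → E × E) (n : ℕ) (d : ℝ) :
    (∑ i ∈ range n, Real.sigmoid (d - W (ω i).1)) - ∑ i ∈ range n, Real.sigmoid (W (ω i).2 - d) =
      barFn 0 (fun i : Fin n => W (ω i).1) (fun i : Fin n => -W (ω i).2) d := by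
  unfold barFn fermiWeight
  rw [Fin.sum_univ_eq_sum_range (fun i => 1 / (1 + Real.exp (0 + W (ω i).1 - d))) n,
    Fin.sum_univ_eq_sum_range (fun i => 1 / (1 + Real.exp (-0 + -W (ω i).2 + d))) n]
  congr 1
  · refine sum_congr rfl fun i _ => ?_
    rw [Real.sigmoid_def, one_div, show 0 + W (ω i).1 - d = -(d - W (ω i).1) by ring]
  · refine sum_congr rfl fun i _ => ?_
    rw [Real.sigmoid_def, one_div, show -0 + -W (ω i).2 + d = -(W (ω i).2 - d) by ring]

omit [MeasurableSpace E] in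
/-- **The sample Bennett equation has exactly one root** for every `n ≥ 1` and every run
(`barFn_existsUnique_root` of the finite file). -/
theorem existsUnique_sampleBarGap_root (ω : ℕ → E × E) {n : ℕ} (hn : 1 ≤ n) :
    ∃! d : ℝ, (∑ i ∈ range n, Real.sigmoid (d - W (ω i).1)) -
      ∑ i ∈ range n, Real.sigmoid (W (ω i).2 - d) = 0 := by
  haveI : Nonempty (Fin n) := ⟨⟨0, hn⟩⟩
  simp_rw [sampleBarGap_eq_barFn W ω n]
  exact barFn_existsUnique_root 0 _ _

variable {W} in
/-- **A measurable root selection exists**: there is `d̂ : ℕ → (ℕ → E × E) → ℝ`, measurable in the run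
for every `n`, solving the sample Bennett equation for every `n ≥ 1` and every run — "the BAR estimate"
as a random variable (`{d̂_n ≤ x} = {0 ≤ g_n(x, ·)}` by monotonicity; `measurable_of_Iic`). -/
theorem exists_measurable_barRoot (hW : Measurable W) :
    ∃ dhat : ℕ → (ℕ → E × E) → ℝ, (∀ n, Measurable (dhat n)) ∧
      ∀ n, 1 ≤ n → ∀ ω, (∑ i ∈ range n, Real.sigmoid (dhat n ω - W (ω i).1)) -
        ∑ i ∈ range n, Real.sigmoid (W (ω i).2 - dhat n ω) = 0 := by
  classical
  have hex := fun n (hn : 1 ≤ n) (ω : ℕ → E × E) => existsUnique_sampleBarGap_root W ω hn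
  refine ⟨fun n ω => if hn : 1 ≤ n then (hex n hn ω).exists.choose else 0, fun n => ?_,
    fun n hn ω => ?_⟩
  · by_cases hn : 1 ≤ n
    · simp only [hn, dif_pos]
      refine measurable_of_Iic fun x => ?_
      have hset : (fun ω : ℕ → E × E => (hex n hn ω).exists.choose) ⁻¹' Iic x =
          {ω | 0 ≤ (∑ i ∈ range n, Real.sigmoid (x - W (ω i).1)) -
            ∑ i ∈ range n, Real.sigmoid (W (ω i).2 - x)} := by
        ext ω
        simp only [Set.mem_preimage, Set.mem_Iic, Set.mem_setOf_eq]
        have hroot := (hex n hn ω).exists.choose_spec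
        constructor
        · intro hle
          rw [← hroot]
          exact sampleBarGap_monotone W ω n hle
        · intro hge
          by_contra hlt
          have hlt' := sampleBarGap_strictMono W ω hn (lt_of_not_ge hlt)
          dsimp only at hlt'
          linarith
      rw [hset]
      exact measurableSet_le measurable_const (measurable_sampleBarGap hW n x)
    · simp only [hn, dif_neg, not_false_eq_true]
      exact measurable_const
  · simp only [hn, dif_pos]
    exact (hex n hn ω).exists.choose_spec

end Sample

/-! ## The strong law at a fixed `d`, eventual sign separation, convergence of every root -/

section TwoLaws

variable (μF μR : Measure E) [IsProbabilityMeasure μF] [IsProbabilityMeasure μR]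
variable {W : E → ℝ}

/-- **Strong law for the sample Bennett gap at a fixed `d`**: along almost every paired run,
`g_n(d, ω)/n → G(d) = E_{μF} σ(d − W) − E_{μR} σ(W − d)`. -/
theorem tendsto_sampleBarGap_div_ae (hW : Measurable W) (d : ℝ) :
    ∀ᵐ ω ∂(Measure.infinitePi fun _ : ℕ => μF.prod μR),
      Tendsto (fun n : ℕ => ((∑ i ∈ range n, Real.sigmoid (d - W (ω i).1)) -
        ∑ i ∈ range n, Real.sigmoid (W (ω i).2 - d)) / n) atTop
        (𝓝 ((∫ a, Real.sigmoid (d - W a) ∂μF) - ∫ a, Real.sigmoid (W a - d) ∂μR)) := by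
  set μ := μF.prod μR with hμ
  have hm1 : Measurable fun p : E × E => Real.sigmoid (d - W p.1) :=
    _root_.continuous_sigmoid.measurable.comp (measurable_const.sub (hW.comp measurable_fst))
  have hm2 : Measurable fun p : E × E => Real.sigmoid (W p.2 - d) :=
    _root_.continuous_sigmoid.measurable.comp ((hW.comp measurable_snd).sub measurable_const)
  have hi1 : Integrable (fun p : E × E => Real.sigmoid (d - W p.1)) μ :=
    integrable_sigmoid_comp (measurable_const.sub (hW.comp measurable_fst))
  have hi2 : Integrable (fun p : E × E => Real.sigmoid (W p.2 - d)) μ :=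
    integrable_sigmoid_comp ((hW.comp measurable_snd).sub measurable_const)
  have hgi : Integrable (fun p : E × E => Real.sigmoid (d - W p.1) - Real.sigmoid (W p.2 - d)) μ :=
    hi1.sub hi2
  have hmean : ∫ p, (Real.sigmoid (d - W p.1) - Real.sigmoid (W p.2 - d)) ∂μ =
      (∫ a, Real.sigmoid (d - W a) ∂μF) - ∫ a, Real.sigmoid (W a - d) ∂μR := by
    rw [integral_sub hi1 hi2,
      integral_comp_of_measurePreserving (measurePreserving_fst (μ := μF) (ν := μR))
        (g := fun a => Real.sigmoid (d - W a))
        (_root_.continuous_sigmoid.measurable.comp (measurable_const.sub hW)).aestronglyMeasurable,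
      integral_comp_of_measurePreserving (measurePreserving_snd (μ := μF) (ν := μR))
        (g := fun a => Real.sigmoid (W a - d))
        (_root_.continuous_sigmoid.measurable.comp (hW.sub measurable_const)).aestronglyMeasurable]
  filter_upwards [tendsto_sampleMean_ae μ
    (g := fun p : E × E => Real.sigmoid (d - W p.1) - Real.sigmoid (W p.2 - d)) (hm1.sub hm2) hgi]
    with ω hω
  rw [hmean] at hω
  refine hω.congr fun n => ?_
  unfold sampleMean
  rw [Fin.sum_univ_eq_sum_range (fun i => Real.sigmoid (d - W (ω i).1) - Real.sigmoid (W (ω i).2 - d)) n,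
    sum_sub_distrib]

/-- **Eventual sign separation.**  If `d⋆` is a root of the population gap,
`E_{μF} σ(d⋆ − W) = E_{μR} σ(W − d⋆)`, then for almost every paired run and every `δ > 0`: for all
large `n`, the sample gap is negative on `(−∞, d⋆ − δ]` and positive on `[d⋆ + δ, ∞)`. -/
theorem eventually_sampleBarGap_sign_ae (hW : Measurable W) {dstar : ℝ}
    (hroot : ∫ a, Real.sigmoid (dstar - W a) ∂μF = ∫ a, Real.sigmoid (W a - dstar) ∂μR) :
    ∀ᵐ ω ∂(Measure.infinitePi fun _ : ℕ => μF.prod μR), ∀ δ : ℝ, 0 < δ →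
      ∀ᶠ n : ℕ in atTop,
        (∀ d ≤ dstar - δ, (∑ i ∈ range n, Real.sigmoid (d - W (ω i).1)) -
          ∑ i ∈ range n, Real.sigmoid (W (ω i).2 - d) < 0) ∧
        (∀ d ≥ dstar + δ, 0 < (∑ i ∈ range n, Real.sigmoid (d - W (ω i).1)) -
          ∑ i ∈ range n, Real.sigmoid (W (ω i).2 - d)) := by
  have hG := strictMono_integral_sigmoid_sub μF μR hW
  have hG0 : (∫ a, Real.sigmoid (dstar - W a) ∂μF) - ∫ a, Real.sigmoid (W a - dstar) ∂μR = 0 :=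
    sub_eq_zero.2 hroot
  -- the strong law at the countably many points `dstar ± 1/(k+1)`
  have hup : ∀ᵐ ω ∂(Measure.infinitePi fun _ : ℕ => μF.prod μR), ∀ k : ℕ,
      Tendsto (fun n : ℕ => ((∑ i ∈ range n, Real.sigmoid (dstar + 1 / (k + 1) - W (ω i).1)) -
        ∑ i ∈ range n, Real.sigmoid (W (ω i).2 - (dstar + 1 / (k + 1)))) / n) atTop
        (𝓝 ((∫ a, Real.sigmoid (dstar + 1 / (k + 1) - W a) ∂μF) -
          ∫ a, Real.sigmoid (W a - (dstar + 1 / (k + 1))) ∂μR)) :=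
    ae_all_iff.2 fun k => tendsto_sampleBarGap_div_ae μF μR hW _
  have hdn : ∀ᵐ ω ∂(Measure.infinitePi fun _ : ℕ => μF.prod μR), ∀ k : ℕ,
      Tendsto (fun n : ℕ => ((∑ i ∈ range n, Real.sigmoid (dstar - 1 / (k + 1) - W (ω i).1)) -
        ∑ i ∈ range n, Real.sigmoid (W (ω i).2 - (dstar - 1 / (k + 1)))) / n) atTop
        (𝓝 ((∫ a, Real.sigmoid (dstar - 1 / (k + 1) - W a) ∂μF) -
          ∫ a, Real.sigmoid (W a - (dstar - 1 / (k + 1))) ∂μR)) :=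
    ae_all_iff.2 fun k => tendsto_sampleBarGap_div_ae μF μR hW _
  filter_upwards [hup, hdn] with ω hωup hωdn δ hδ
  obtain ⟨k, hk⟩ := exists_nat_one_div_lt hδ
  have hkpos : (0 : ℝ) < 1 / ((k : ℝ) + 1) := by positivity
  -- limits at the two bracketing points have the right signs
  have hGup : 0 < (∫ a, Real.sigmoid (dstar + 1 / (k + 1) - W a) ∂μF) -
      ∫ a, Real.sigmoid (W a - (dstar + 1 / (k + 1))) ∂μR := by
    have := hG (show dstar < dstar + 1 / (k + 1) by linarith)
    dsimp only at this
    linarith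
  have hGdn : (∫ a, Real.sigmoid (dstar - 1 / (k + 1) - W a) ∂μF) -
      ∫ a, Real.sigmoid (W a - (dstar - 1 / (k + 1))) ∂μR < 0 := by
    have := hG (show dstar - 1 / (k + 1) < dstar by linarith)
    dsimp only at this
    linarith
  have hevup := (hωup k).eventually (lt_mem_nhds hGup)
  have hevdn := (hωdn k).eventually (gt_mem_nhds hGdn)
  filter_upwards [hevup, hevdn, eventually_gt_atTop 0] with n hnup hndn hn
  have hn' : (0 : ℝ) < n := by exact_mod_cast hn
  have hposup : 0 < (∑ i ∈ range n, Real.sigmoid (dstar + 1 / (k + 1) - W (ω i).1)) -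
      ∑ i ∈ range n, Real.sigmoid (W (ω i).2 - (dstar + 1 / (k + 1))) := by
    by_contra hle
    have : ((∑ i ∈ range n, Real.sigmoid (dstar + 1 / (k + 1) - W (ω i).1)) -
        ∑ i ∈ range n, Real.sigmoid (W (ω i).2 - (dstar + 1 / (k + 1)))) / n ≤ 0 :=
      div_nonpos_of_nonpos_of_nonneg (not_lt.1 hle) hn'.le
    linarith
  have hnegdn : (∑ i ∈ range n, Real.sigmoid (dstar - 1 / (k + 1) - W (ω i).1)) -
      ∑ i ∈ range n, Real.sigmoid (W (ω i).2 - (dstar - 1 / (k + 1))) < 0 := by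
    by_contra hle
    have : 0 ≤ ((∑ i ∈ range n, Real.sigmoid (dstar - 1 / (k + 1) - W (ω i).1)) -
        ∑ i ∈ range n, Real.sigmoid (W (ω i).2 - (dstar - 1 / (k + 1)))) / n :=
      div_nonneg (not_lt.1 hle) hn'.le
    linarith
  have hmono := sampleBarGap_monotone W ω n
  constructor
  · intro d hd
    have h1 := hmono (show d ≤ dstar - 1 / (k + 1) by linarith)
    dsimp only at h1
    linarith
  · intro d hd
    have h1 := hmono (show dstar + 1 / (k + 1) ≤ d by linarith)
    dsimp only at h1
    linarith

/-- **Every root sequence converges to the population root.**  If `d⋆` is a root of the population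
gap, then for almost every paired run: every real sequence `d_n` that solves the sample Bennett
equation for all large `n` converges to `d⋆`.  (One null set for all sequences.) -/
theorem tendsto_barRoot_ae (hW : Measurable W) {dstar : ℝ}
    (hroot : ∫ a, Real.sigmoid (dstar - W a) ∂μF = ∫ a, Real.sigmoid (W a - dstar) ∂μR) :
    ∀ᵐ ω ∂(Measure.infinitePi fun _ : ℕ => μF.prod μR), ∀ dseq : ℕ → ℝ,
      (∀ᶠ n : ℕ in atTop, (∑ i ∈ range n, Real.sigmoid (dseq n - W (ω i).1)) -
        ∑ i ∈ range n, Real.sigmoid (W (ω i).2 - dseq n) = 0) →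
      Tendsto dseq atTop (𝓝 dstar) := by
  filter_upwards [eventually_sampleBarGap_sign_ae μF μR hW hroot] with ω hω dseq hdseq
  rw [Metric.tendsto_atTop]
  intro ε hε
  obtain ⟨N, hN⟩ := ((hω ε hε).and hdseq).exists_forall_of_atTop
  refine ⟨N, fun n hn => ?_⟩
  obtain ⟨⟨hlo, hhi⟩, hz⟩ := hN n hn
  rw [Real.dist_eq, abs_lt]
  constructor
  · by_contra hle
    have := hlo (dseq n) (by linarith)
    linarith
  · by_contra hle
    have := hhi (dseq n) (by linarith)
    linarith

end TwoLaws

/-! ## Crooks pairs: the self-consistent BAR estimate converges to `ΔF` -/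

namespace CrooksPair

variable {Ω : Type*} [MeasurableSpace Ω]
variable {ν₀ ν₁ : Measure Ω} {κF κR : Kernel Ω E} {s e : E → Ω} {W : E → ℝ}

/-- **Eventual sign separation around `ΔF`.**  For every Crooks pair with `e^{−ΔF} = Z₁/Z₀` and
every `δ > 0`: along almost every run of independent paired evolutions, for all large `n` the sample
Bennett gap is negative at every `d ≤ ΔF − δ` and positive at every `d ≥ ΔF + δ` — a bracketing
root search started anywhere ends inside `(ΔF − δ, ΔF + δ)`. -/
theorem eventually_sampleBarGap_sign_ae [IsFiniteMeasure ν₀] [IsFiniteMeasure ν₁]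
    [IsMarkovKernel κF] [IsMarkovKernel κR] (h0 : ν₀ univ ≠ 0) (h1 : ν₁ univ ≠ 0)
    (h : CrooksPair ν₀ ν₁ κF κR s e W) {ΔF : ℝ}
    (hΔF : Real.exp (-ΔF) = ((ν₀ univ)⁻¹ * ν₁ univ).toReal) :
    ∀ᵐ ω ∂(Measure.infinitePi fun _ : ℕ => (fwdPathLaw ν₀ κF).prod (fwdPathLaw ν₁ κR)),
      ∀ δ : ℝ, 0 < δ → ∀ᶠ n : ℕ in atTop,
        (∀ d ≤ ΔF - δ, (∑ i ∈ range n, Real.sigmoid (d - W (ω i).1)) -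
          ∑ i ∈ range n, Real.sigmoid (W (ω i).2 - d) < 0) ∧
        (∀ d ≥ ΔF + δ, 0 < (∑ i ∈ range n, Real.sigmoid (d - W (ω i).1)) -
          ∑ i ∈ range n, Real.sigmoid (W (ω i).2 - d)) := by
  haveI := isProbabilityMeasure_fwdPathLaw ν₀ h0 κF
  haveI := isProbabilityMeasure_fwdPathLaw ν₁ h1 κR
  exact GeneralNCMC.eventually_sampleBarGap_sign_ae (fwdPathLaw ν₀ κF) (fwdPathLaw ν₁ κR)
    h.measurable_W
    ((h.integral_sigmoid_fwd_eq_rev_iff h0 h1 hΔF ΔF).2 rfl)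

/-- **Strong consistency of the self-consistent Bennett estimate.**  For every Crooks pair with
`e^{−ΔF} = Z₁/Z₀`: along almost every run of independent paired evolutions (one forward evolution
from prior equilibrium, one reverse from target equilibrium per pair), EVERY sequence `d_n` solving
the sample Bennett equation `Σ_{i<n} σ(d − W_i) = Σ_{i<n} σ(W'_i − d)` for all large `n` converges to
`ΔF`.  The statistic is NOT frozen: this is the root the engine reports (`snf.estimators.bar`). -/
theorem tendsto_barRoot_ae [IsFiniteMeasure ν₀] [IsFiniteMeasure ν₁]
    [IsMarkovKernel κF] [IsMarkovKernel κR] (h0 : ν₀ univ ≠ 0) (h1 : ν₁ univ ≠ 0)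
    (h : CrooksPair ν₀ ν₁ κF κR s e W) {ΔF : ℝ}
    (hΔF : Real.exp (-ΔF) = ((ν₀ univ)⁻¹ * ν₁ univ).toReal) :
    ∀ᵐ ω ∂(Measure.infinitePi fun _ : ℕ => (fwdPathLaw ν₀ κF).prod (fwdPathLaw ν₁ κR)),
      ∀ dseq : ℕ → ℝ,
        (∀ᶠ n : ℕ in atTop, (∑ i ∈ range n, Real.sigmoid (dseq n - W (ω i).1)) -
          ∑ i ∈ range n, Real.sigmoid (W (ω i).2 - dseq n) = 0) →
        Tendsto dseq atTop (𝓝 ΔF) := by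
  haveI := isProbabilityMeasure_fwdPathLaw ν₀ h0 κF
  haveI := isProbabilityMeasure_fwdPathLaw ν₁ h1 κR
  exact GeneralNCMC.tendsto_barRoot_ae (fwdPathLaw ν₀ κF) (fwdPathLaw ν₁ κR) h.measurable_W
    ((h.integral_sigmoid_fwd_eq_rev_iff h0 h1 hΔF ΔF).2 rfl)

/-- **The BAR estimator, as a random variable, converges to `ΔF` almost surely**: for any root
selection `d̂` (e.g. the measurable one of `exists_measurable_barRoot`) solving the sample equation for
every `n ≥ 1`, `d̂_n → ΔF` a.s. -/
theorem tendsto_measurable_barRoot_ae [IsFiniteMeasure ν₀] [IsFiniteMeasure ν₁]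
    [IsMarkovKernel κF] [IsMarkovKernel κR] (h0 : ν₀ univ ≠ 0) (h1 : ν₁ univ ≠ 0)
    (h : CrooksPair ν₀ ν₁ κF κR s e W) {ΔF : ℝ}
    (hΔF : Real.exp (-ΔF) = ((ν₀ univ)⁻¹ * ν₁ univ).toReal) {dhat : ℕ → (ℕ → E × E) → ℝ}
    (hdhat : ∀ n, 1 ≤ n → ∀ ω, (∑ i ∈ range n, Real.sigmoid (dhat n ω - W (ω i).1)) -
      ∑ i ∈ range n, Real.sigmoid (W (ω i).2 - dhat n ω) = 0) :
    ∀ᵐ ω ∂(Measure.infinitePi fun _ : ℕ => (fwdPathLaw ν₀ κF).prod (fwdPathLaw ν₁ κR)),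
      Tendsto (fun n => dhat n ω) atTop (𝓝 ΔF) := by
  filter_upwards [h.tendsto_barRoot_ae h0 h1 hΔF] with ω hω
  exact hω (fun n => dhat n ω) (eventually_atTop.2 ⟨1, fun n hn => hdhat n hn ω⟩)

end CrooksPair

end Summit.Ventures.LatticeQCDFlow.Exactness.GeneralNCMC
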